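import Summits.BirchSwinnertonDyer.BirchSwinnertonDyer.Theorems.TeichmullerTwistDescentLocalPTorsionLineUnramified
import Summits.BirchSwinnertonDyer.BirchSwinnertonDyer.Theorems.KimAtThreeFineKatoKPortGoodSubgroup
import HarnessLib

/-!
# `E(K)[p] = 0` over a finite Galois `K ⊇ ℚ_p` with `gcd([K : ℚ_p], p − 1) = 1` and no `ζ_p`, from
# `E(ℚ_p)[p] = 0` — the Kosters–Pannekoek clause of F″ over the unramified completions, by Galois DESCENT

Route `EdixhovenFibreFiveSeven`, crux K★ `StarredOptimalManinUnitFiveSeven` (stmt-BirchSwinnertonDyer-22226),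
line `kato-lever`, seat `bsd-line-edix-p2` g4; `--supports` 22226 (helper toward the ONE open stub F″ =
`Literature.NumberTheory.EllipticCurves.kato_neron_isIntegral_twistedSymbolSum_of_additive_five_le`, programme piece
P2 of `Cruxes/StarredOptimalManinUnitFiveSeven/Lines/kato-lever-F2-programme.md`: the TORSION INPUT
`E₀(K_v)[p] = 0` of the receptacle `Λ̃ : E₀(K_v) ↠ 𝒪_{K_v}` landed by seat edix-p1 g5,
`…Theorems.StarredOptimalManinUnitFiveSevenReceptacleLogLattice`). TOOL theorems only (no definition, no named fact,
no `sorry`); nothing is closed or booked; BSD is not proved by any of this.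

WHY. F″'s side clause at `p ∈ {5, 7}` reads `gcd(ord_m p, p − 1) = 1 ∧ V(ℚ_p)[p] = 0`; the receptacle is applied
over `K_v = ℚ(ζ_m)_v`, `v ∣ p`, which is Galois over `ℚ_p`, UNRAMIFIED, of degree `[K_v : ℚ_p] = ord_m p`, and needs
`E₀(K_v)[p] = 0`. F″'s docstring derives this from Kosters–Pannekoek's invariant (`ūⁿ = 1`, `ū ∈ 𝔽_p`,
`gcd(n, p − 1) = 1 ⇒ ū = 1`). THIS file proves the stronger, reduction-free statement **`E(K)[p] = 0`** by DESCENT,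
with no Kosters–Pannekoek analysis: (i) `E(K)[p]` is a LINE — cyclic of order dividing `p` — for every elliptic curve
over a characteristic-`0` field without a primitive `p`-th root of unity (seat ttd-p1's
`LocalPTorsionLine.exists_generator_of_forall_not_isPrimitiveRoot`, from `#E(K̄)[p] = p²` and the tree's PROVED
Weil-pairing corollary); (ii) an additive self-map of finite order `n` with `gcd(n, p − 1) = 1` that preserves a
`p`-torsion line FIXES it pointwise (`§1`, Fermat's little theorem in `ℤ/p`: the eigenvalue `k` has `kⁿ = k^{p−1} = 1`);
(iii) every `σ ∈ Gal(K/ℚ_p)` has order dividing `#Gal = [K : ℚ_p]`, so fixes `E(K)[p]` pointwise; (iv) Galois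
descent of points (tree `KPort.exists_map_ofId_eq_of_forall_map_eq`) puts every `p`-torsion point in
`ι E(ℚ_p)[p] = 0`. For an unramified `K ⊋ ℚ_p` and `p` odd, `ζ_p ∉ K` (`e(ℚ_p(ζ_p)/ℚ_p) = p − 1 > 1`); that input
is seat ttd-p1's `LocalPTorsionLine.not_isPrimitiveRoot_of_unramified_padicAlgebra` (Eisenstein at `Φ_p(X+1)`), used in §3.

* §1 `iterate_map_eq_pow_nsmul`, `nsmul_eq_self_of_pow_coprime` (pure group theory / `ZMod p`),
  **`map_eq_self_of_iterate_eq_of_coprime`** — a finite-order additive map preserving a `p`-torsion line fixes it.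
* §2 **`map_galois_eq_self_of_prime_nsmul_eq_zero`** (every `σ ∈ Gal(K/ℚ_p)` fixes `E(K)[p]` when
  `gcd([K:ℚ_p], p−1) = 1`, `ζ_p ∉ K`), **`eq_zero_of_prime_nsmul_eq_zero_of_coprime_finrank`** (`E(ℚ_p)[p] = 0 ⇒
  E(K)[p] = 0`), and the `E₀(K)` form the receptacle consumes
  (`forall_nonsingularReductionSubgroup_prime_nsmul_eq_zero`).
* §3 UNRAMIFIED `K`, `p` odd: **`eq_zero_of_prime_nsmul_eq_zero_of_unramified_of_coprime`** and its `E₀(K)` form —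
  exactly F″'s clause `gcd([K:ℚ_p], p−1) = 1 ∧ E(ℚ_p)[p] = 0 ⇒ E(K)[p] = 0`.

References: [KostersPannekoek2017] M. Kosters, R. Pannekoek, arXiv:1703.07888, Thm. 1 (iii)–(iv) (the statement
being re-derived: over `K/ℚ_p` unramified of degree `n` with `gcd(n, p − 1) = 1` the exceptional case is
`E(ℚ_p)[p] ≠ 0`); [KimNakamura2020] C.-H. Kim, K. Nakamura, J. Number Theory 210 (2020), Thm. 2.1, Remark 1.8 (1);
[SilvermanAEC2009] J. H. Silverman, *The Arithmetic of Elliptic Curves*, 2nd ed., III.6.4(b), III.8.1.1 (Weil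
pairing), VII.2; [SerreLocalFields1979] J.-P. Serre, *Local Fields*, IV §4 (`ℚ_p(ζ_p)` totally ramified).
-/

set_option autoImplicit false
-- the Theorems namespace of a single-conjunct summit repeats the summit name by design (D-0017)
set_option linter.dupNamespace false

noncomputable section

open scoped Classical
open _root_.WeierstrassCurve

namespace Summit.BirchSwinnertonDyer.BirchSwinnertonDyer.Theorems.ReceptacleTorsion

/-! ## §1 A finite-order additive map preserving a `p`-torsion line fixes it (`gcd(n, p − 1) = 1`) -/

section Line

variable {A : Type*} [AddCommGroup A] {p : ℕ} [hp : Fact p.Prime]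

/-- If `f P = k • P` for an additive map `f` then `f^[n] P = kⁿ • P`. [folklore] -/
theorem iterate_map_eq_pow_nsmul (f : A →+ A) {P : A} {k : ℕ} (hk : f P = k • P) (n : ℕ) :
    f^[n] P = k ^ n • P := by
  induction n with
  | zero => simp
  | succ n ih => rw [Function.iterate_succ_apply', ih, map_nsmul, hk, smul_smul, pow_succ]

omit hp in
/-- `k • P` depends only on `k mod p` when `p • P = 0`. [folklore] -/
theorem nsmul_eq_mod_nsmul {P : A} (hP : p • P = 0) (k : ℕ) : k • P = (k % p) • P := by
  conv_lhs => rw [← Nat.mod_add_div k p, add_nsmul, mul_comm, mul_nsmul', hP, nsmul_zero, add_zero]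

/-- **Fermat + coprimality**: if `P ≠ 0` is `p`-torsion, `kⁿ • P = P` with `0 < n` and `gcd(n, p − 1) = 1`, then
`k • P = P` (`k` is a unit mod `p` of order dividing `n` and `p − 1`, hence `k ≡ 1`). [folklore] -/
theorem nsmul_eq_self_of_pow_coprime {P : A} (hP : p • P = 0) (hP0 : P ≠ 0) {k n : ℕ} (hn : 0 < n)
    (hkn : k ^ n • P = P) (hcop : n.Coprime (p - 1)) : k • P = P := by
  have hpP : addOrderOf P = p := by
    have h := addOrderOf_dvd_of_nsmul_eq_zero hP
    rcases (Nat.dvd_prime hp.out).mp h with h1 | h1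
    · exact absurd (AddMonoid.addOrderOf_eq_one_iff.mp h1) hP0
    · exact h1
  -- equal multiples of `P` have equal residues mod `p`
  have hres : ∀ a b : ℕ, a • P = b • P → ((a : ZMod p)) = (b : ZMod p) := by
    intro a b hab
    rw [nsmul_eq_mod_nsmul hP a, nsmul_eq_mod_nsmul hP b] at hab
    have hlt1 : a % p < addOrderOf P := by rw [hpP]; exact Nat.mod_lt _ hp.out.pos
    have hlt2 : b % p < addOrderOf P := by rw [hpP]; exact Nat.mod_lt _ hp.out.pos
    exact (ZMod.natCast_eq_natCast_iff' _ _ _).mpr ((nsmul_injOn_Iio_addOrderOf (x := P)) hlt1 hlt2 hab)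
  -- `k̄ ≠ 0` (else `kⁿ • P = 0 ≠ P`)
  have hk : ((k : ZMod p)) ≠ 0 := by
    intro hk0
    rw [ZMod.natCast_eq_zero_iff] at hk0
    have : k ^ n • P = 0 := by
      obtain ⟨c, hc⟩ := hk0
      obtain ⟨m, rfl⟩ := Nat.exists_eq_succ_of_ne_zero hn.ne'
      rw [pow_succ, hc, show (p * c) ^ m * (p * c) = (p * c) ^ m * c * p by ring, mul_nsmul', hP, nsmul_zero]
    exact hP0 (hkn.symm.trans this)
  -- in `ZMod p`: `k̄ⁿ = 1` and `k̄^{p−1} = 1`, so `k̄ = 1`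
  have hkn' : ((k : ZMod p)) ^ n = 1 := by
    have h1 : (k ^ n) • P = (1 : ℕ) • P := by rw [hkn, one_nsmul]
    simpa using hres _ _ h1
  have hkp : ((k : ZMod p)) ^ (p - 1) = 1 := ZMod.pow_card_sub_one_eq_one hk
  have hord : orderOf ((k : ZMod p)) = 1 := by
    have h := Nat.dvd_gcd (orderOf_dvd_of_pow_eq_one hkn') (orderOf_dvd_of_pow_eq_one hkp)
    rwa [hcop.gcd_eq_one, Nat.dvd_one] at h
  rw [orderOf_eq_one_iff] at hord
  have hk1 : k % p = 1 % p := (ZMod.natCast_eq_natCast_iff' _ _ _).mp (by simpa using hord)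
  rw [nsmul_eq_mod_nsmul hP k, hk1, ← nsmul_eq_mod_nsmul hP 1, one_nsmul]

/-- **A finite-order additive map preserving a `p`-torsion LINE fixes it pointwise** (`gcd(n, p − 1) = 1`): if the
`p`-torsion of `A` consists of the multiples of one `p`-torsion element `G`, and `f : A →+ A` satisfies
`f^[n] = id` on `G` with `0 < n`, `gcd(n, p − 1) = 1`, then `f Q = Q` for every `Q` with `p • Q = 0`. [folklore] -/
theorem map_eq_self_of_iterate_eq_of_coprime {G : A} (hG : p • G = 0) (hline : ∀ Q : A, p • Q = 0 → ∃ k : ℕ, Q = k • G)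
    (f : A →+ A) {n : ℕ} (hn : 0 < n) (hfn : f^[n] G = G) (hcop : n.Coprime (p - 1)) {Q : A} (hQ : p • Q = 0) :
    f Q = Q := by
  -- `f G` is `p`-torsion, so `f G = k • G`
  have hfG : p • f G = 0 := by rw [← map_nsmul, hG, map_zero]
  obtain ⟨k, hk⟩ := hline _ hfG
  have hGfix : f G = G := by
    by_cases hG0 : G = 0
    · rw [hG0, map_zero]
    · have hkn : k ^ n • G = G := by rw [← iterate_map_eq_pow_nsmul f hk n, hfn]
      rw [hk]
      exact nsmul_eq_self_of_pow_coprime hG hG0 hn hkn hcop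
  obtain ⟨m, rfl⟩ := hline Q hQ
  rw [map_nsmul, hGfix]

end Line

/-! ## §2 Galois descent: every `σ ∈ Gal(K/ℚ_p)` fixes `E(K)[p]`; `E(ℚ_p)[p] = 0 ⇒ E(K)[p] = 0` -/

section Descent

open Summit.BirchSwinnertonDyer.Rank1Residual.Additive.BallEval

variable {p : ℕ} [hp : Fact p.Prime] {K : Type*} [NontriviallyNormedField K] [NormedAlgebra ℚ_[p] K]
  [IsUltrametricDist K] [FiniteDimensional ℚ_[p] K] [IsGalois ℚ_[p] K] {M : WeierstrassCurve ℤ_[p]}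
  [hE : (M.map PadicInt.Coe.ringHom).IsElliptic]

omit [IsUltrametricDist K] [FiniteDimensional ℚ_[p] K] [IsGalois ℚ_[p] K] hE in
/-- The identity of `Gal(K/ℚ_p)` acts trivially on `E(K)`. [folklore] -/
theorem map_galois_one (P : ((M.map PadicInt.Coe.ringHom).baseChange K).toAffine.Point) :
    Affine.Point.map (W' := (M.map PadicInt.Coe.ringHom).toAffine) ((1 : K ≃ₐ[ℚ_[p]] K) : K →ₐ[ℚ_[p]] K) P = P := by
  rcases P with _ | ⟨x, y, h⟩
  · rfl
  · rw [Affine.Point.map_some]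
    rfl

omit [IsUltrametricDist K] [FiniteDimensional ℚ_[p] K] [IsGalois ℚ_[p] K] hE in
/-- Iterating `σ` on `E(K)` is acting by `σⁿ`. [folklore] -/
theorem iterate_map_galois (σ : K ≃ₐ[ℚ_[p]] K) (n : ℕ)
    (P : ((M.map PadicInt.Coe.ringHom).baseChange K).toAffine.Point) :
    (Affine.Point.map (W' := (M.map PadicInt.Coe.ringHom).toAffine) (σ : K →ₐ[ℚ_[p]] K))^[n] P =
      Affine.Point.map (W' := (M.map PadicInt.Coe.ringHom).toAffine) ((σ ^ n : K ≃ₐ[ℚ_[p]] K) : K →ₐ[ℚ_[p]] K) P := by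
  induction n with
  | zero => rw [Function.iterate_zero, id, pow_zero, map_galois_one]
  | succ n ih =>
    rw [Function.iterate_succ_apply', ih, Affine.Point.map_map]
    have hcomp : ((σ : K →ₐ[ℚ_[p]] K).comp ((σ ^ n : K ≃ₐ[ℚ_[p]] K) : K →ₐ[ℚ_[p]] K)) =
        ((σ ^ (n + 1) : K ≃ₐ[ℚ_[p]] K) : K →ₐ[ℚ_[p]] K) := by
      ext x
      rw [pow_succ']
      rfl
    rw [hcomp]

omit [IsUltrametricDist K] in
/-- **Every `σ ∈ Gal(K/ℚ_p)` fixes `E(K)[p]` pointwise** when `K/ℚ_p` is finite Galois with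
`gcd([K : ℚ_p], p − 1) = 1` and `K` has no primitive `p`-th root of unity: `E(K)[p]` is a line (seat ttd-p1's
`LocalPTorsionLine.exists_generator_of_forall_not_isPrimitiveRoot`, Weil pairing), `σ` has order dividing
`#Gal(K/ℚ_p) = [K : ℚ_p]`, and §1. [cite: SilvermanAEC2009, Cor. III.8.1.1] [cite: KostersPannekoek2017, Thm. 1 (iii)-(iv)] -/
theorem map_galois_eq_self_of_prime_nsmul_eq_zero (hμ : ∀ ζ : K, ¬ IsPrimitiveRoot ζ p)
    (hcop : (Module.finrank ℚ_[p] K).Coprime (p - 1)) (σ : K ≃ₐ[ℚ_[p]] K)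
    {Q : ((M.map PadicInt.Coe.ringHom).baseChange K).toAffine.Point} (hQ : p • Q = 0) :
    Affine.Point.map (W' := (M.map PadicInt.Coe.ringHom).toAffine) (σ : K →ₐ[ℚ_[p]] K) Q = Q := by
  haveI : ((M.map PadicInt.Coe.ringHom).baseChange K).IsElliptic :=
    inferInstanceAs ((M.map PadicInt.Coe.ringHom).map (algebraMap ℚ_[p] K)).IsElliptic
  haveI : CharZero K := charZero_of_injective_algebraMap (algebraMap ℚ_[p] K).injective
  obtain ⟨G, hG, hline⟩ :=
    TeichmullerTwistDescent.LocalPTorsionLine.exists_generator_of_forall_not_isPrimitiveRoot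
      ((M.map PadicInt.Coe.ringHom).baseChange K) p hμ
  have hn : 0 < orderOf σ := orderOf_pos σ
  have hfn : (Affine.Point.map (W' := (M.map PadicInt.Coe.ringHom).toAffine) (σ : K →ₐ[ℚ_[p]] K))^[orderOf σ] G
      = G := by
    rw [iterate_map_galois, pow_orderOf_eq_one, map_galois_one]
  have hdvd : orderOf σ ∣ Module.finrank ℚ_[p] K := by
    rw [← IsGalois.card_aut_eq_finrank ℚ_[p] K]
    exact orderOf_dvd_natCard σ
  exact map_eq_self_of_iterate_eq_of_coprime hG hline _ hn hfn (Nat.Coprime.coprime_dvd_left hdvd hcop) hQ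

/-- **`E(ℚ_p)[p] = 0 ⟹ E(K)[p] = 0`** for `K/ℚ_p` finite Galois with `gcd([K : ℚ_p], p − 1) = 1` and no
primitive `p`-th root of unity in `K` (e.g. `K` UNRAMIFIED and `p` odd — the completions `ℚ(ζ_m)_v`, `p ∤ m`, of
F″'s clause `gcd(ord_m p, p − 1) = 1`), for `E = M ⊗ K` (`BallEval.curveK p K M`), ANY reduction type: every
`σ` fixes the `p`-torsion (previous theorem), so by Galois descent (`KPort.exists_map_ofId_eq_of_forall_map_eq`) it
comes from `E(ℚ_p)[p] = 0`. Re-derives Kosters–Pannekoek's exceptional-case criterion over unramified `K` of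
degree prime to `p − 1` without their invariant `ū`. [cite: KostersPannekoek2017, Thm. 1 (iii)-(iv) and Cor. 2]
[cite: KimNakamura2020, Thm. 2.1 and Remark 1.8 (1)] [cite: SilvermanAEC2009, Cor. III.8.1.1] -/
theorem eq_zero_of_prime_nsmul_eq_zero_of_coprime_finrank (hμ : ∀ ζ : K, ¬ IsPrimitiveRoot ζ p)
    (hcop : (Module.finrank ℚ_[p] K).Coprime (p - 1))
    (h0 : ∀ P₀ : (M.map PadicInt.Coe.ringHom).toAffine.Point, p • P₀ = 0 → P₀ = 0)
    {Q : (curveK p K M).toAffine.Point} (hQ : p • Q = 0) : Q = 0 := by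
  have hfix : ∀ σ : K ≃ₐ[ℚ_[p]] K,
      Affine.Point.map (W' := (M.map PadicInt.Coe.ringHom).toAffine) (σ : K →ₐ[ℚ_[p]] K) Q = Q :=
    fun σ => map_galois_eq_self_of_prime_nsmul_eq_zero hμ hcop σ hQ
  obtain ⟨P₀, hP₀⟩ := KPort.exists_map_ofId_eq_of_forall_map_eq hfix
  have hp0 : p • P₀ = 0 := by
    apply Affine.Point.map_injective (W' := (M.map PadicInt.Coe.ringHom).toAffine) (Algebra.ofId ℚ_[p] K)
    have h1 :=
      (Affine.Point.map (W' := (M.map PadicInt.Coe.ringHom).toAffine) (Algebra.ofId ℚ_[p] K)).map_nsmul p P₀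
    have h2 := (Affine.Point.map (W' := (M.map PadicInt.Coe.ringHom).toAffine) (Algebra.ofId ℚ_[p] K)).map_zero
    rw [hP₀] at h1
    exact h1.trans (hQ.trans h2.symm)
  obtain rfl : P₀ = 0 := h0 P₀ hp0
  rw [← hP₀]
  exact map_zero _

/-- **The receptacle's torsion input, `E₀(K)` form**: under the same hypotheses every `P ∈ E₀(K)` of `M ⊗ K`
killed by `p` is `O` — the hypothesis `E₀(K)[p] = 0` of seat edix-p1 g5's
`StarredOptimalManinUnitFiveSevenReceptacle.exists_mem_nonsingularReductionSubgroup_satLog_eq` (`Λ̃ : E₀(K) ↠ 𝒪_K`).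
[cite: KostersPannekoek2017, Thm. 1 (iii)-(iv)] [cite: KimNakamura2020, Thm. 2.1] -/
theorem forall_nonsingularReductionSubgroup_prime_nsmul_eq_zero
    (hμ : ∀ ζ : K, ¬ IsPrimitiveRoot ζ p) (hcop : (Module.finrank ℚ_[p] K).Coprime (p - 1))
    (h0 : ∀ P₀ : (M.map PadicInt.Coe.ringHom).toAffine.Point, p • P₀ = 0 → P₀ = 0) :
    ∀ P ∈ (M.map (coeffHom p K)).nonsingularReductionSubgroup
        (Valuation.integer.integers (NormedField.valuation (K := K))),
      p • (P : (curveK p K M).toAffine.Point) = 0 → P = 0 :=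
  fun _ _ hP => eq_zero_of_prime_nsmul_eq_zero_of_coprime_finrank hμ hcop h0 hP

end Descent

/-! ## §3 UNRAMIFIED `K`, `p` odd: no `ζ_p` (seat ttd-p1), hence the receptacle's torsion input from
`E(ℚ_p)[p] = 0` alone -/

section Unramified

open Summit.BirchSwinnertonDyer.Rank1Residual.Additive.BallEval

variable {p : ℕ} [hp : Fact p.Prime] {K : Type*} [NontriviallyNormedField K] [NormedAlgebra ℚ_[p] K]
  [IsUltrametricDist K] [FiniteDimensional ℚ_[p] K] [IsGalois ℚ_[p] K] {M : WeierstrassCurve ℤ_[p]}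
  [hE : (M.map PadicInt.Coe.ringHom).IsElliptic]

/-- **Kosters–Pannekoek's clause by descent — `E(ℚ_p)[p] = 0 ⟹ E(K)[p] = 0` over an UNRAMIFIED finite Galois
`K ⊇ ℚ_p` of degree prime to `p − 1`, `p` odd** (`‖x‖ < 1 ⇒ ‖x‖ ≤ ‖p‖`; the completions `K_v = ℚ(ζ_m)_v`, `p ∤ m`,
`[K_v : ℚ_p] = ord_m p`, of F″'s clause `gcd(ord_m p, p − 1) = 1 ∧ V(ℚ_p)[p] = 0`), for `E = M ⊗ K`, ANY reduction
type: `ζ_p ∉ K` is seat ttd-p1's `LocalPTorsionLine.not_isPrimitiveRoot_of_unramified_padicAlgebra`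
(`‖ζ_p − 1‖^{p−1} = ‖p‖`, Eisenstein), then §2. [cite: KostersPannekoek2017, Thm. 1 (iii)-(iv) and Cor. 2]
[cite: KimNakamura2020, Thm. 2.1 and Remark 1.8 (1)] [cite: SerreLocalFields1979, IV §4 Prop. 17] -/
theorem eq_zero_of_prime_nsmul_eq_zero_of_unramified_of_coprime (hp2 : p ≠ 2)
    (hK : ∀ x : K, ‖x‖ < 1 → ‖x‖ ≤ ‖(p : K)‖) (hcop : (Module.finrank ℚ_[p] K).Coprime (p - 1))
    (h0 : ∀ P₀ : (M.map PadicInt.Coe.ringHom).toAffine.Point, p • P₀ = 0 → P₀ = 0)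
    {Q : (curveK p K M).toAffine.Point} (hQ : p • Q = 0) : Q = 0 :=
  eq_zero_of_prime_nsmul_eq_zero_of_coprime_finrank
    (TeichmullerTwistDescent.LocalPTorsionLine.not_isPrimitiveRoot_of_unramified_padicAlgebra p hp2 hK) hcop h0 hQ

/-- **The receptacle's torsion input in F″'s general branch**: `W … E₀(K)[p] = 0` for `M ⊗ K` over an unramified
finite Galois `K ⊇ ℚ_p` with `gcd([K : ℚ_p], p − 1) = 1`, `p` odd, whenever `E(ℚ_p)[p] = 0` — the hypothesis
`hnoP` of seat edix-p1 g5's `StarredOptimalManinUnitFiveSevenReceptacle.exists_mem_nonsingularReductionSubgroup_satLog_eq`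
(`Λ̃ : E₀(K) ↠ 𝒪_K`). [cite: KostersPannekoek2017, Thm. 1 (iii)-(iv)] [cite: KimNakamura2020, Thm. 2.1] -/
theorem forall_nonsingularReductionSubgroup_prime_nsmul_eq_zero_of_unramified (hp2 : p ≠ 2)
    (hK : ∀ x : K, ‖x‖ < 1 → ‖x‖ ≤ ‖(p : K)‖) (hcop : (Module.finrank ℚ_[p] K).Coprime (p - 1))
    (h0 : ∀ P₀ : (M.map PadicInt.Coe.ringHom).toAffine.Point, p • P₀ = 0 → P₀ = 0) :
    ∀ P ∈ (M.map (coeffHom p K)).nonsingularReductionSubgroup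
        (Valuation.integer.integers (NormedField.valuation (K := K))),
      p • (P : (curveK p K M).toAffine.Point) = 0 → P = 0 :=
  fun _ _ hP => eq_zero_of_prime_nsmul_eq_zero_of_unramified_of_coprime hp2 hK hcop h0 hP

end Unramified

end Summit.BirchSwinnertonDyer.BirchSwinnertonDyer.Theorems.ReceptacleTorsion

end
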